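import Mathlib
import Literature.NumberTheory.Automorphic.TwistedQuotientConeDescentStep
import Literature.NumberTheory.Automorphic.ResGLnConeDictionaryCone
import Literature.NumberTheory.Automorphic.ResGLnCohomology
import Summits.Langlands.Langlands.Theorems.IrreducibilityBySelfDualityHeckeEigenvalueFieldDescentTower
import HarnessLib

/-!
# Crux `HeckeEigenvalueField` (stmt-Langlands-13632), line `Sketch` — stub FAM-STAIR-ALG1: the corrected
# per-coset staircase is smooth, equivariant and a tower

Namespace `Summit.Langlands.Langlands.Theorems.HeckeEigenvalueField.Res`; theorems only; setting of
`Literature/NumberTheory/Automorphic/TwistedQuotientConeDescent{,Rows,Step}.lean`.  For a family `ω` of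
smooth closed equivariant `(q+1)`-forms placed in degree `q + 1` (`single`) and an equivariant `b`, the
staircase `κ_j = stair j` (`j < q`) with the corrected bottom step `κ_q = stair q - E(ε_{q+1} b)`
(constant `0`-forms, `ε_p = (-1)^{p(p+1)/2}`) is smooth and equivariant on `X` and is a tower
`dκ_{j+1} = δκ_j` (`FamStairAlg.main1`, from the landed tower file `…DescentTower`).  The registered stub
`stub_fam_stair_alg1` is the instance `Γ = 𝒢 = Γc ≤ GL_n(K)⁺` fixing the level coset `cL` (`L = ⊤`),
`ω = coneForm η cL.out` (closed and equivariant by `IsConeFormFamily`, `Γc`-invariant as `Γc` fixes `cL`).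
[cite: BottTu1982Forms, §I.4 and §II.9] [cite: Dupont1976, §1–2]
-/

set_option linter.dupNamespace false -- project-wide: `Summit.Langlands.Langlands` is the mandated namespace

noncomputable section

open scoped Matrix.Norms.Operator Topology
open Filter

attribute [-instance] instTopologicalSpaceMatrix
attribute [-instance] Matrix.instUniformSpace
attribute [local instance high] NormedAddCommGroup.toSeminormedAddCommGroup

open scoped Classical Matrix TensorProduct ContDiff
open Set NumberField NumberField.mixedEmbedding Literature.Analysis.Calculus Literature.Geometry.Kaehler
open Literature.NumberTheory.Automorphic Literature.NumberTheory.Automorphic.TwistedQuotient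

namespace Summit.Langlands.Langlands.Theorems.HeckeEigenvalueField.Res

open ResGLnCohomology BigHeckeGLn

namespace FamStairAlg

variable {Γ 𝒢 : Type} [Group Γ] [Group 𝒢] (ι : Γ →* 𝒢) (L : Subgroup 𝒢)
  {V : Type} [NormedAddCommGroup V] [NormedSpace ℂ V]
  (ρ : Representation ℂ Γ V)
  {W : Type} [NormedAddCommGroup W] [NormedSpace ℝ W]
  (a : Γ →* (W →L[ℝ] W)) {X : Set W} {x₀ : W}

variable [FiniteDimensional ℂ V] in
/-- A family `ω` equivariant on the `Γ`-stable `X` (`ω_{γc}(γy)(γv) = ρ(γ) ω_c(y)(v)`) gives a total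
family `single (c ↦ ω c.out)` fixed by the action on `X`, in every degree. [cite: Dupont1976, §1–2] -/
theorem single_eq_famAct (hmaps : ∀ γ : Γ, MapsTo (a γ) X X) {k : ℕ} (om : 𝒢 → W → W [⋀^Fin k]→L[ℝ] V)
    (hωeq : ∀ (γ : Γ) (c : 𝒢 ⧸ L), ∀ y ∈ X, ∀ v : Fin k → W,
      om (ι γ • c).out (a γ y) (fun j => a γ (v j)) = ρ γ (om c.out y v))
    (γ : Γ) (c : 𝒢 ⧸ L) (r : ℕ) : ∀ x ∈ X, TwistedQuotient.single L (fun c => om c.out) c r x =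
      famAct ι L ρ a γ (TwistedQuotient.single L fun c => om c.out) c r x := by
  intro x hx
  rw [famAct_eq_actAlt]
  by_cases h : r = k
  · subst h
    rw [single_self, single_self]
    ext v
    rw [actAlt_apply]
    simpa only [smul_inv_smul, act_apply_inv] using
      hωeq γ ((ι γ)⁻¹ • c) (a γ⁻¹ x) (hmaps γ⁻¹ hx) fun i => a γ⁻¹ (v i)
  · rw [single_of_ne L _ c h, single_of_ne L _ _ h, Pi.zero_apply, Pi.zero_apply, map_zero]

variable [FiniteDimensional ℂ V] in
/-- The action on a constant `0`-form is the coefficient action on its value. [folklore] -/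
theorem actAlt_constOfIsEmpty (δ : Γ) (m : V) :
    actAlt ρ a δ 0 (ContinuousAlternatingMap.constOfIsEmpty ℝ W (Fin 0) m) =
      ContinuousAlternatingMap.constOfIsEmpty ℝ W (Fin 0) (ρ δ m) := by
  ext v
  simp only [actAlt_apply, ContinuousAlternatingMap.constOfIsEmpty_apply]

/-- **FAM-STAIR-ALG1, generic form**: for `ω` smooth, closed and equivariant on the open convex `Γ`-stable
`X ∋ x₀` and `b` equivariant, `κ_j = stair j` (`j < q`), `κ_q = stair q - E(ε_{q+1} b)` are smooth and
equivariant on `X` (`smoothOn_stair`, `isEquivariantOn_stair`, constant cochains) and form a tower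
`dκ_{j+1} = δκ_j` on `X` (`cochD_stair_succ`). [cite: BottTu1982Forms, §II.9] [cite: Dupont1976, §1–2] -/
theorem main1 [CompleteSpace V] [FiniteDimensional ℂ V] [FiniteDimensional ℝ W]
    (hXo : IsOpen X) (hXc : Convex ℝ X) (hmaps : ∀ γ : Γ, MapsTo (a γ) X X) (hx₀ : x₀ ∈ X)
    {q : ℕ} (om : 𝒢 → W → W [⋀^Fin (q + 1)]→L[ℝ] V) (hωs : ∀ c, ContDiffOn ℝ ∞ (om c) X)
    (hωd : ∀ c : 𝒢 ⧸ L, ∀ x ∈ X, extDeriv (om c.out) x = 0)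
    (hωeq : ∀ (γ : Γ) (c : 𝒢 ⧸ L), ∀ y ∈ X, ∀ v : Fin (q + 1) → W,
      om (ι γ • c).out (a γ y) (fun j => a γ (v j)) = ρ γ (om c.out y v))
    (b : (Fin (q + 1) → Γ) → V) (hbeq : ∀ (γ : Γ) (g : Fin (q + 1) → Γ), b (fun i => γ * g i) = ρ γ (b g))
    (κ : (j : ℕ) → Coch Γ L W V j)
    (hκlt : ∀ j, j < q → κ j = stair L a (TwistedQuotient.single L fun c => om c.out) x₀ j)
    (hκq0 : ∀ (g : Fin (q + 1) → Γ) (c : 𝒢 ⧸ L) (x : W), κ q g c 0 x =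
      stair L a (TwistedQuotient.single L fun c => om c.out) x₀ q g c 0 x -
        ContinuousAlternatingMap.constOfIsEmpty ℝ W (Fin 0)
          ((((-1 : ℝ) ^ ((q + 1) * (q + 2) / 2)) : ℂ) • b g))
    (hκqs : ∀ (g : Fin (q + 1) → Γ) (c : 𝒢 ⧸ L) (r : ℕ) (x : W), κ q g c (r + 1) x =
      stair L a (TwistedQuotient.single L fun c => om c.out) x₀ q g c (r + 1) x) :
    (∀ j ≤ q, SmoothOn L X (κ j)) ∧
    (∀ j ≤ q, IsEquivariantOn ι L ρ (a := a) X (κ j)) ∧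
    ∀ j, j < q → ∀ (g : Fin (j + 2) → Γ) (c : 𝒢 ⧸ L) (r : ℕ), ∀ x ∈ X,
      cochD L (κ (j + 1)) g c r x = delta L (κ j) g c r x := by
  have hom_s : ∀ (c : 𝒢 ⧸ L) (r : ℕ), ContDiffOn ℝ ∞ (TwistedQuotient.single L (fun c => om c.out) c r) X := by
    intro c r
    by_cases h : r = q + 1
    · subst h; rw [single_self]; exact hωs c.out
    · rw [single_of_ne L _ c h]; exact contDiffOn_const
  have hom_d : ∀ (c : 𝒢 ⧸ L) (r : ℕ), ∀ x ∈ X,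
      extDeriv (TwistedQuotient.single L (fun c => om c.out) c r) x = 0 := by
    intro c r x hx
    by_cases h : r = q + 1
    · subst h; rw [single_self]; exact hωd c x hx
    · rw [single_of_ne L _ c h]
      simp only [extDeriv, fderiv_zero, Pi.zero_apply]
      exact map_zero (ContinuousAlternatingMap.alternatizeUncurryFinCLM ℝ W V)
  have hom_0 := fun (c : 𝒢 ⧸ L) (r : ℕ) (hr : r ≠ q + 1) => single_of_ne L (fun c => om c.out) c hr
  have he : ∀ (γ : Γ) (g : Fin (q + 1) → Γ),
      (((-1 : ℝ) ^ ((q + 1) * (q + 2) / 2)) : ℂ) • b (fun i => γ * g i) =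
        ρ γ ((((-1 : ℝ) ^ ((q + 1) * (q + 2) / 2)) : ℂ) • b g) := fun γ g => by
    rw [hbeq, map_smul]
  have hsm := smoothOn_stair L a hXo hXc hmaps hx₀ _ hom_s
  have heqv := isEquivariantOn_stair ι L ρ a hXo hXc hmaps hx₀ _ hom_s
    (single_eq_famAct ι L ρ a hmaps om hωeq)
  have hvan := stair_apply_eq_zero L a (x₀ := x₀) _ hom_0
  refine ⟨?_, ?_, ?_⟩
  · -- (1) smoothness on `X`
    have htop : SmoothOn L X (κ q) := by
      intro g c r
      cases r with
      | zero => exact ((hsm q g c 0).sub contDiffOn_const).congr fun x _ => hκq0 g c x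
      | succ r => exact (hsm q g c (r + 1)).congr fun x _ => hκqs g c r x
    exact fun j hj => hj.lt_or_eq.elim (fun hlt => by rw [hκlt j hlt]; exact hsm j) fun h => h ▸ htop
  · -- (2) equivariance on `X`
    have htop : IsEquivariantOn ι L ρ (a := a) X (κ q) := by
      intro γ g c r x hx
      cases r with
      | succ r =>
        rw [hκqs, heqv q γ g c (r + 1) x hx, famAct_eq_actAlt, famAct_eq_actAlt, hκqs]
      | zero =>
        rw [hκq0, heqv q γ g c 0 x hx, famAct_eq_actAlt, famAct_eq_actAlt, hκq0, map_sub, he,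
          actAlt_constOfIsEmpty]
    exact fun j hj => hj.lt_or_eq.elim (fun hlt => by rw [hκlt j hlt]; exact heqv j) fun h => h ▸ htop
  · -- (3) the tower `dκ_{j+1} = δκ_j` on `X`
    intro j hj g c r x hx
    rw [hκlt j hj]
    cases r with
    | zero =>
      rw [cochD_apply, famD_zero, Pi.zero_apply, delta_apply]
      simp only [Finset.sum_apply, Pi.smul_apply]
      exact (Finset.sum_eq_zero fun i _ => by rw [hvan j _ c 0 (by omega), Pi.zero_apply, smul_zero]).symm
    | succ r =>
      by_cases hj1 : j + 1 < q
      · rw [hκlt (j + 1) hj1]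
        exact cochD_stair_succ L a hXo hXc hmaps hx₀ _ hom_s hom_d j g c r hx
      · obtain rfl : q = j + 1 := by omega
        have key := cochD_stair_succ L a hXo hXc hmaps hx₀ _ hom_s hom_d j g c r hx
        rw [cochD_apply, famD_succ] at key ⊢; rw [← key]
        cases r with
        | zero =>
          rw [show κ (j + 1) g c 0 = fun y =>
              stair L a (TwistedQuotient.single L fun c => om c.out) x₀ (j + 1) g c 0 y -
                ContinuousAlternatingMap.constOfIsEmpty ℝ W (Fin 0)
                  ((((-1 : ℝ) ^ ((j + 1 + 1) * (j + 1 + 2) / 2)) : ℂ) • b g) from funext (hκq0 g c)]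
          simp only [extDeriv, fderiv_sub_const]
        | succ r =>
          rw [show κ (j + 1) g c (r + 1) =
              stair L a (TwistedQuotient.single L fun c => om c.out) x₀ (j + 1) g c (r + 1) from
            funext (hκqs g c r)]

end FamStairAlg

/-- **Stub FAM-STAIR-ALG1 — the per-coset staircase: smoothness, equivariance, tower.**  On a subgroup
`Γc ≤ GL_n(K)⁺` fixing the level coset `cL` (acting on the cone; one coset `⊤`-quotient), the staircase
`κ_j = stair j` of the single closed smooth form `ω_c = coneForm η cL.out` (`j < q`), with the bottom step
corrected by the restricted coboundary `b` (`κ_q = stair q - E(± b)` in form-degree `0`; `κ` given through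
`hκlt`, `hκq0`, `hκqs`), is smooth and equivariant on the cone and is a tower (`dκ_{j+1} = δκ_j`).  Landed
TOWER p150433 (`smoothOn_stair`, `isEquivariantOn_stair`, `cochD_stair_succ`). [cite: BottTu1982Forms, §I.4 and §II.9] -/
theorem stub_fam_stair_alg1 {n : ℕ} {K : Type} [Field K] [NumberField K]
    (hcpt : isCompact_glFiniteIntegralLevel n K) (𝔫 : Ideal (𝓞 K))
    (π : CuspidalAutomorphicRepData n K hcpt)
    (S : Finset {w : InfinitePlace K // w.IsReal}) (lam : (K →+* ℂ) → Fin n → ℤ) {q : ℕ}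
    {η : ConeDictionary.Cochain π.1 lam (q + 1)}
    (hω : TwistedQuotient.IsConeFormFamily (diagPos n K) (level n K 𝔫) (coeffRepPos ℂ n K lam)
      ((ResGLnCone.coneActionRat n K).comp (glTotPos n K).subtype) (ResGLnCone.posCone n K)
      (fun c H => ConeDictionary.coneForm π.1 S lam η c H))
    (cL : FiniteAdelicGL n K ⧸ level n K 𝔫)
    (hωs : ContDiffOn ℝ ((⊤ : ℕ∞) : WithTop ℕ∞)
      (fun H => @id (ResGLnCone.hermSpace n K [⋀^Fin (q + 1)]→L[ℝ] CoeffModule ℂ n K lam) (ConeDictionary.coneForm π.1 S lam η cL.out H)) (ResGLnCone.posCone n K))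
    (Γc : Subgroup (glTotPos n K)) (hΓc : ∀ γ : Γc, diagPos n K (γ : glTotPos n K) • cL = cL)
    (b : (Fin (q + 1) → Γc) → CoeffModule ℂ n K lam)
    (hbeq : ∀ (γ : Γc) (g : Fin (q + 1) → Γc), b (fun i => γ * g i) = coeffRepPos ℂ n K lam (γ : glTotPos n K) (b g))
    (κ : (j : ℕ) → TwistedQuotient.Coch Γc (⊤ : Subgroup Γc) (ResGLnCone.hermSpace n K) (CoeffModule ℂ n K lam) j)
    (hκlt : ∀ j, j < q → κ j = TwistedQuotient.stair (⊤ : Subgroup Γc)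
        (((ResGLnCone.coneActionRat n K).comp (glTotPos n K).subtype).comp Γc.subtype)
        (TwistedQuotient.single (⊤ : Subgroup Γc) (fun (_ : Γc ⧸ (⊤ : Subgroup Γc)) (H : ResGLnCone.hermSpace n K) =>
          @id (ResGLnCone.hermSpace n K [⋀^Fin (q + 1)]→L[ℝ] CoeffModule ℂ n K lam) (ConeDictionary.coneForm π.1 S lam η cL.out H)))
        (ResGLnCone.hermOne n K) j)
    (hκq0 : ∀ (g : Fin (q + 1) → Γc) (c : Γc ⧸ (⊤ : Subgroup Γc)) (x : ResGLnCone.hermSpace n K),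
      κ q g c 0 x = TwistedQuotient.stair (⊤ : Subgroup Γc)
        (((ResGLnCone.coneActionRat n K).comp (glTotPos n K).subtype).comp Γc.subtype)
        (TwistedQuotient.single (⊤ : Subgroup Γc) (fun (_ : Γc ⧸ (⊤ : Subgroup Γc)) (H : ResGLnCone.hermSpace n K) =>
          @id (ResGLnCone.hermSpace n K [⋀^Fin (q + 1)]→L[ℝ] CoeffModule ℂ n K lam) (ConeDictionary.coneForm π.1 S lam η cL.out H)))
        (ResGLnCone.hermOne n K) q g c 0 x -
        ContinuousAlternatingMap.constOfIsEmpty ℝ (ResGLnCone.hermSpace n K) (Fin 0)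
          ((((-1 : ℝ) ^ ((q + 1) * (q + 2) / 2)) : ℂ) • b g))
    (hκqs : ∀ (g : Fin (q + 1) → Γc) (c : Γc ⧸ (⊤ : Subgroup Γc)) (r : ℕ) (x : ResGLnCone.hermSpace n K),
      κ q g c (r + 1) x = TwistedQuotient.stair (⊤ : Subgroup Γc)
        (((ResGLnCone.coneActionRat n K).comp (glTotPos n K).subtype).comp Γc.subtype)
        (TwistedQuotient.single (⊤ : Subgroup Γc) (fun (_ : Γc ⧸ (⊤ : Subgroup Γc)) (H : ResGLnCone.hermSpace n K) =>
          @id (ResGLnCone.hermSpace n K [⋀^Fin (q + 1)]→L[ℝ] CoeffModule ℂ n K lam) (ConeDictionary.coneForm π.1 S lam η cL.out H)))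
        (ResGLnCone.hermOne n K) q g c (r + 1) x) :
    (∀ j ≤ q, TwistedQuotient.SmoothOn (⊤ : Subgroup Γc) (ResGLnCone.posCone n K) (κ j)) ∧
    (∀ j ≤ q, @TwistedQuotient.IsEquivariantOn Γc Γc _ _ (MonoidHom.id Γc) (⊤ : Subgroup Γc) _ _ _
      ((coeffRepPos ℂ n K lam).comp Γc.subtype) _ _ _
      (((ResGLnCone.coneActionRat n K).comp (glTotPos n K).subtype).comp Γc.subtype) _
      (ResGLnCone.posCone n K) j (κ j)) ∧
    ∀ j, j < q → ∀ (g : Fin (j + 2) → Γc) (c : Γc ⧸ (⊤ : Subgroup Γc)) (r : ℕ), ∀ x ∈ ResGLnCone.posCone n K,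
      TwistedQuotient.cochD (⊤ : Subgroup Γc) (κ (j + 1)) g c r x =
        TwistedQuotient.delta (⊤ : Subgroup Γc) (κ j) g c r x := by
  refine FamStairAlg.main1 (MonoidHom.id Γc) (⊤ : Subgroup Γc) ((coeffRepPos ℂ n K lam).comp Γc.subtype)
    (((ResGLnCone.coneActionRat n K).comp (glTotPos n K).subtype).comp Γc.subtype)
    hω.isOpen hω.convex (fun γ => hω.mapsTo (γ : glTotPos n K)) (ResGLnCone.hermOne_mem_posCone n K)
    (fun (_ : Γc) (H : ResGLnCone.hermSpace n K) =>
      @id (ResGLnCone.hermSpace n K [⋀^Fin (q + 1)]→L[ℝ] CoeffModule ℂ n K lam)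
        (ConeDictionary.coneForm π.1 S lam η cL.out H))
    (fun _ => hωs) (fun _ x hx => hω.extDeriv_eq_zero cL.out x hx) ?_ b hbeq κ hκlt hκq0 hκqs
  -- invariance of `ω_c` under `Γc`: `γ ∈ Γc` fixes the coset `cL`, so `ω_{γ cL.out} = ω_{cL.out}`
  intro γ c y hy v
  have hcos : ((diagPos n K (γ : glTotPos n K) * cL.out : FiniteAdelicGL n K) :
      FiniteAdelicGL n K ⧸ level n K 𝔫) = cL := by
    rw [← smul_eq_mul, MulAction.Quotient.coe_smul_out, hΓc γ]
  have hfun : ConeDictionary.coneForm π.1 S lam η (diagPos n K (γ : glTotPos n K) * cL.out) =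
      ConeDictionary.coneForm π.1 S lam η cL.out := by
    have h := hω.apply_out_mk (diagPos n K (γ : glTotPos n K) * cL.out)
    rw [hcos] at h; exact h.symm
  have key := hω.equivariant (γ : glTotPos n K) cL.out y hy v
  rw [hfun] at key; exact key

end Summit.Langlands.Langlands.Theorems.HeckeEigenvalueField.Res

end
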